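import Summits.HodgeConjecture.HodgeConjecture.Theorems.R90S10ThetaLineOfXi                  -- ★ p864606 (this seat): the `ξ.ψ`-line R4 block; brings ★ S5 `chiOneOfOneDim`, ★ C2 carriers `H1 H1Loc`, `IsLinked`
import Summits.HodgeConjecture.HodgeConjecture.Theorems.R90S5DiscreteClassMultPos            -- ★ `DiscreteClass.one_le_mult_mk`
import Literature.NumberTheory.Automorphic.CharacterLineFinConstituents                       -- ★ `isConstituentOf_finRep_smoothPart_comp_inclPlace_iff_of_forall_apply_eq_smul'`
import Literature.NumberTheory.Automorphic.AdelicCommutativeDatumMultiplicityOne              -- ★ `multiplicity_le_one_and_isOneDimensional_adelicGroupData_one`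
import HarnessLib

/-!
# R90-TF · S10 (Rogawski 1990 §13.8) · THEOREMS — `R90S10ThetaLineOfChar`: the θ-BLOCK OF ★ `S10HDatum` FOR AN ARBITRARY AUTOMORPHIC CHARACTER `Θ` OF `U(Φ₁)(𝔸)`
# (RULING J-θ (β′): block C hypothesis-first over an ABSTRACT automorphic character line) — R4′ `μ₁ θ hθ ν₁v χv hχv` + (C-i) `d₁ hlink₁ hd₁`, closed

Cell hodgecm-mathlib, slab R90-TF, section S10 = §13.8, crux item h413 = stmt-HodgeConjecture-24833 (route `route-HodgeConjecture-HCCMUnconditional`).  Prover seat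
R90-C138-p05 (g0), RULING J-θ (R90-C138-plan (g3), 2026-09-05T02:36Z) on census `CENSUS-40b-thetaLineGlobal.md` d666bc68: «the θ-LINE OF RECORD IS NOT `ξ.ψ ∘ det`: block C goes
HYPOTHESIS-FIRST over an ABSTRACT automorphic character line `θ` of `U(Φ₁)` with the two pins (`hθv : θ_v = chiOneOfOneDim ξ v`, `hθunr`); R4′ = ★ p864606 re-run for an arbitrary
automorphic `θ` (`thetaLine_of_char`)».  THIS FILE is that re-run, PLUS the global half (C-i) of block C: the discrete class `d₁` of the line, `hlink₁`, and `hd₁ : m(θ) = 1`.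

PRINT → PROOF (Rogawski 1990 §13.8 p. 218 L9–10 «`ρ = ρ′ ⊠ θ`», p. 219 L1–2; §13.3 pp. 202–203 «`n(ξ) = 1`»; §11.1 (the anisotropic torus); [Gelbart1975, §2.A; Thm. 10.10]).  Let `Θ`
be a unitary automorphic character of `U(Φ₁)(𝔸_{L⁺})` (★ `AdelicGroupData.AutomorphicCharacter (H1 L)`) and `θloc w : U(Φ₁)(L⁺_w) →* ℂˣ` its local components with open
kernels, read in the ★ `cmDatum` model through ★ `localPiEquiv` ∕ ★ `inclPlaceAdelic` (`hΘ : θloc w (localPiEquiv w u) = Θ (inclPlaceAdelic w u)`).  The LINE `ℂ · [Θ] ⊂ L²`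
(★ `DiscreteAutomorphicRep.ofChar Θ⁻¹ μ₁`, on which `R(g) = Θ(g)`, ★ `ofChar_toContRep_apply`) is a discrete automorphic representation whose finite local constituents at `w`
are EXACTLY `⟦ℂ_{θloc w}⟧` (★ `isConstituentOf_finRep_smoothPart_comp_inclPlace_iff_of_forall_apply_eq_smul'` [Flath] + ★ `comap_mk_ofChar`), with an irreducible admissible
finite component (★ `exists_irreducible_admissible_hasFinComponent_ofChar`, ★ `smoothConstituents_iff_of_hasFinComponent`): so the family `(⟦ℂ_{θloc w}⟧)_w` OCCURS
(★ `cmOccursInDiscreteSpectrum`), its class `d₁` is LINKED to it (★ `IsLinked`), and `m(d₁) = 1` (★ `multiplicity_le_one_and_isOneDimensional_adelicGroupData_one` [Gelbart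
Thm. 10.10] + ★ `one_le_mult_mk`).  The trace pin `Tr θ_w(f₁) = ∫ f₁ θloc_w dν` is ★ `IrrClass.smoothTrace_mk_ofChar_of_mem` (as in ★ R4-1).

CONTENTS (theorems only; no `def`, no `instance`, no `notation`, no `sorry`; axioms ⊆ {propext, Classical.choice, Quot.sound}).
* `smoothTrace_charClass_eq_integral w χ hχ ν f₁ hf` — `⟦ℂ_χ⟧.smoothTrace ν f₁ = ∫ z, f₁ z * χ z ∂ν` on `U(Φ₁)(L⁺_w)` for ANY open-kernel character `χ` (R4-1 generalised).
* `charLine_occurs_linked_multOne μ₁ Θ θloc hθo hΘ` — `cmOccursInDiscreteSpectrum … (⟦ℂ_{θloc w}⟧)_w ∧ IsLinked … (mk (ofChar Θ⁻¹ μ₁)) (⟦ℂ_{θloc w}⟧)_w ∧ (mk (ofChar Θ⁻¹ μ₁)).mult = 1`.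
* `thetaLine_of_char_of_measure` (R4′ for `Θ`) — `∃ θ χv, hθ ∧ (θ = (⟦ℂ_{θloc w}⟧)_w) ∧ (χv = θloc v) ∧ hχv`, for a GIVEN automorphic `μ₁`.
* `thetaLine_of_char` — the same with `μ₁` produced (★ `exists_isAutomorphicMeasure_H1`).
* `thetaBlockC_of_char_of_measure` — R4′ + (C-i) in ★ `S10HDatum`'s field order: `∃ θ χv d₁, hθ ∧ θ = … ∧ χv = … ∧ hχv ∧ IsLinked … d₁ θ ∧ d₁.mult = 1 ∧ d₁ = mk (ofChar Θ⁻¹ μ₁)`.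
BINDERS (honest): `Θ`, its local components `θloc` with `hθo` (open kernels) and the compatibility `hΘ` are PARAMETERS — the pins of RULING J-θ (`θloc v = chiOneOfOneDim ξ v`,
unramified off `v`) are NOT used here (they enter `hfac₁ ∕ hpin ∕ hθi` downstream); the EXISTENCE of such a `Θ` for the crux's `ξ` is the named residual letter L-C′
`TorusCharExtendLetter` (torus Grunwald–Wang at non-split `v`), not this file.  NON-VACUITY: `Θ := 1` with `θloc := 1` satisfies `hθo`, `hΘ` trivially.

HONEST LABEL: R4′ + (C-i) of `sock_S10_realiseH₂`'s payer table; pays no socket; (C-ii) `ν₁i χi` + R10 and (C-iii) `hθi` follow (census d666bc68, ★-to-be `classTrace_mk_ofChar`).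
HC_CM is proved only modulo the 7 printed citations (2 remaining named inputs: hLiu418 = stmt-HodgeConjecture-24832, h413 = stmt-HodgeConjecture-24833) until rung 0 closes;
count-neutral helper; REL ≠ ★ ≠ BUILT.  Namespace `Summit.HodgeConjecture.HodgeConjecture.R90.S10`.

## References
* [Rogawski1990] J. D. Rogawski, *Automorphic Representations of Unitary Groups in Three Variables*, Ann. of Math. Stud. 123 (1990): §13.8 p. 218 L9–10, p. 219 L1–2; §13.3
  pp. 202–203; §11.1; §13.1 Prop. 13.1.4 p. 199.
* [Gelbart1975] S. Gelbart, *Automorphic forms on adele groups*, Ann. of Math. Stud. 83 (1975), §2.A; Thm. 10.10 (proof, p. 158).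
* [FlathCorvallis1979] D. Flath, *Decomposition of representations into tensor products*, PSPM 33.1 (1979), Thm. 3.
* [Borel1963] A. Borel, *Some finiteness properties of adele groups over number fields*, Publ. Math. IHÉS 16 (1963), Thm. 5.8.
-/

set_option autoImplicit false
-- the mandated namespace repeats the single-problem summit's segment (`HodgeConjecture.HodgeConjecture`)
set_option linter.dupNamespace false

noncomputable section

open NumberField IsDedekindDomain MeasureTheory
open scoped Matrix
open Literature.NumberTheory Literature.NumberTheory.Automorphic Literature.NumberTheory.Automorphic.UnitaryGroup
open Literature.NumberTheory.Rogawski1990 Literature.NumberTheory.GaloisRepresentations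
open Summit.HodgeConjecture.HodgeConjecture.Cruxes.H413
open Summit.HodgeConjecture.HodgeConjecture.Cruxes.H413.F0P3GlobalPacketDiscrete
open Summit.HodgeConjecture.HodgeConjecture.Cruxes.H413.K2E1TraceFormulaBeta (Pl)
open Summit.HodgeConjecture.HodgeConjecture.Cruxes.H413.K2E1SpectralTermsDiscreteHalf
open Summit.HodgeConjecture.HodgeConjecture.Cruxes.H413.F0P3cPKtupleU1Line (comap_mk_ofChar isOpen_ker_comp_equiv)

namespace Summit.HodgeConjecture.HodgeConjecture.R90.S10

variable (L : Type) [Field L] [NumberField L] [IsCMField L]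

/-- (R4-1′) **`Tr ⟦ℂ_χ⟧(f₁) = ∫ f₁ χ dν` on `U(Φ₁)(L⁺_w)`** for every character `χ` with open kernel, every locally constant compactly supported `f₁` and every left-invariant `ν`
finite on compacts (★ `IrrClass.smoothTrace_mk_ofChar_of_mem` + ★ `charDist`, factors commuted; ★ `nonarchimedeanGroup_cmLocal L 1 w`). [cite: Rogawski1990, §13.1 Prop. 13.1.4 p. 199] -/
theorem smoothTrace_charClass_eq_integral (w : Pl L) [MeasurableSpace (H1Loc L w)] [BorelSpace (H1Loc L w)]
    (χ : H1Loc L w →* ℂˣ) (hχ : IsOpen (((χ.ker : Subgroup (H1Loc L w))) : Set (H1Loc L w)))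
    (ν : Measure (H1Loc L w)) [ν.IsMulLeftInvariant] [IsFiniteMeasureOnCompacts ν] (f₁ : H1Loc L w → ℂ) (hf : IsLocSmooth f₁) :
    (IrrClass.mk (SmoothIrrep.ofChar χ hχ)).smoothTrace ν f₁ = ∫ z, f₁ z * ((χ z : ℂˣ) : ℂ) ∂ν := by
  haveI : NonarchimedeanGroup (H1Loc L w) := nonarchimedeanGroup_cmLocal L 1 w
  rw [IrrClass.smoothTrace_mk_ofChar_of_mem ν hχ ⟨hf.1, hf.2⟩, charDist]
  exact integral_congr_ae (Filter.Eventually.of_forall fun z => mul_comm _ _)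

/-- **THE LINE OF AN AUTOMORPHIC CHARACTER `Θ` OF `U(Φ₁)(𝔸)`: OCCURRENCE, LINKAGE, MULTIPLICITY ONE.**  For `Θ` (★ `AutomorphicCharacter`) with local components `θloc w` (open kernels,
`hΘ : θloc w ∘ localPiEquiv w = Θ ∘ inclPlaceAdelic w`): the family `(⟦ℂ_{θloc w}⟧)_w` OCCURS in the discrete spectrum of `U(Φ₁)` (witness the line ★ `ofChar Θ⁻¹ μ₁`, `R(g) = Θ(g)`),
its class `d₁ := mk (ofChar Θ⁻¹ μ₁)` is ★ `IsLinked` to it, and `d₁.mult = 1` [Gelbart Thm. 10.10].  Finite constituents by ★ `isConstituentOf_finRep_smoothPart_comp_inclPlace_iff_of_forall_apply_eq_smul'`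
+ ★ `comap_mk_ofChar`; finite component by ★ `exists_irreducible_admissible_hasFinComponent_ofChar` + ★ `smoothConstituents_iff_of_hasFinComponent`.
[cite: Rogawski1990, §13.3 pp. 202–203; §11.1; §13.8 p. 218 L9–10] [cite: Gelbart1975, §2.A; Thm. 10.10 (proof, p. 158)] [cite: FlathCorvallis1979, Thm. 3] -/
theorem charLine_occurs_linked_multOne (μ₁ : Measure (H1 L).automorphicQuotient) [(H1 L).IsAutomorphicMeasure μ₁]
    (Θ : (H1 L).AutomorphicCharacter) (θloc : ∀ w : Pl L, H1Loc L w →* ℂˣ)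
    (hθo : ∀ w : Pl L, IsOpen ((((θloc w).ker : Subgroup (H1Loc L w))) : Set (H1Loc L w)))
    (hΘ : ∀ (w : Pl L) (u : localPi L (IsCMField.complexConj L) 1 (Matrix.of fun i j : Fin 1 => if i.val + j.val + 1 = 1 then (1 : L) else 0) w),
      θloc w (localPiEquiv L (IsCMField.complexConj L) 1 (Matrix.of fun i j : Fin 1 => if i.val + j.val + 1 = 1 then (1 : L) else 0) w u) =
        Θ (inclPlaceAdelic (↥(maximalRealSubfield L)) L (IsCMField.complexConj L) 1 (Matrix.of fun i j : Fin 1 => if i.val + j.val + 1 = 1 then (1 : L) else 0) w u)) :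
    cmOccursInDiscreteSpectrum L 1 (Matrix.of fun i j : Fin 1 => if i.val + j.val + 1 = 1 then (1 : L) else 0) μ₁
        (fun w : Pl L => (IrrClass.mk (SmoothIrrep.ofChar (θloc w) (hθo w)) : IrrClass (H1Loc L w))) ∧
      IsLinked L 1 (Matrix.of fun i j : Fin 1 => if i.val + j.val + 1 = 1 then (1 : L) else 0) μ₁ (DiscreteClass.mk (DiscreteAutomorphicRep.ofChar Θ⁻¹ μ₁))
        (fun w : Pl L => (IrrClass.mk (SmoothIrrep.ofChar (θloc w) (hθo w)) : IrrClass (H1Loc L w))) ∧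
      (DiscreteClass.mk (DiscreteAutomorphicRep.ofChar Θ⁻¹ μ₁)).mult = 1 := by
  have hP : ∀ (g : (H1 L).Adelic) (f : (DiscreteAutomorphicRep.ofChar Θ⁻¹ μ₁).space.toSubmodule),
      (DiscreteAutomorphicRep.ofChar Θ⁻¹ μ₁).space.toContRep g f = ((Θ g : ℂˣ) : ℂ) • f := fun g f => by
    rw [DiscreteAutomorphicRep.ofChar_toContRep_apply, AdelicGroupData.AutomorphicCharacter.coe_inv_apply, inv_inv]
  set P := DiscreteAutomorphicRep.ofChar Θ⁻¹ μ₁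
  have hθe : ∀ w : Pl L, IsOpen (((((θloc w).comp (localPiEquiv L (IsCMField.complexConj L) 1 (Matrix.of fun i j : Fin 1 => if i.val + j.val + 1 = 1 then (1 : L) else 0) w).toMonoidHom).ker :
      Subgroup (localPi L (IsCMField.complexConj L) 1 (Matrix.of fun i j : Fin 1 => if i.val + j.val + 1 = 1 then (1 : L) else 0) w))) :
      Set (localPi L (IsCMField.complexConj L) 1 (Matrix.of fun i j : Fin 1 => if i.val + j.val + 1 = 1 then (1 : L) else 0) w)) := fun w =>
    isOpen_ker_comp_equiv _ _ (hθo w)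
  -- `comap (localPiEquiv w) ⟦ℂ_{θloc w}⟧ = ⟦ℂ_{θloc w ∘ localPiEquiv w}⟧`
  have hcm : ∀ w : Pl L,
      IrrClass.comap (localPiEquiv L (IsCMField.complexConj L) 1 (Matrix.of fun i j : Fin 1 => if i.val + j.val + 1 = 1 then (1 : L) else 0) w)
          (IrrClass.mk (SmoothIrrep.ofChar (θloc w) (hθo w))) =
        IrrClass.mk (SmoothIrrep.ofChar ((θloc w).comp (localPiEquiv L (IsCMField.complexConj L) 1 (Matrix.of fun i j : Fin 1 => if i.val + j.val + 1 = 1 then (1 : L) else 0) w).toMonoidHom) (hθe w)) :=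
    fun w => comap_mk_ofChar _ (θloc w) (hθo w) (hθe w)
  -- the finite local constituents of the line at `w`, in the `localPi` model
  have key : ∀ (w : Pl L) (c₀ : IrrClass (localPi L (IsCMField.complexConj L) 1 (Matrix.of fun i j : Fin 1 => if i.val + j.val + 1 = 1 then (1 : L) else 0) w)),
      c₀.IsConstituentOf (P.finRep.smoothPart.toRepresentation.comp
        (inclPlace (↥(maximalRealSubfield L)) L (IsCMField.complexConj L) 1 (Matrix.of fun i j : Fin 1 => if i.val + j.val + 1 = 1 then (1 : L) else 0) w)) ↔
      c₀ = IrrClass.mk (SmoothIrrep.ofChar ((θloc w).comp (localPiEquiv L (IsCMField.complexConj L) 1 (Matrix.of fun i j : Fin 1 => if i.val + j.val + 1 = 1 then (1 : L) else 0) w).toMonoidHom) (hθe w)) :=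
    fun w c₀ => isConstituentOf_finRep_smoothPart_comp_inclPlace_iff_of_forall_apply_eq_smul' P Θ.toMonoidHom Θ.continuous hP w (hθe w) (fun u => hΘ w u) c₀
  obtain ⟨W, _, _, σ, hirr, hadm, hPσ⟩ := R90.S5.exists_irreducible_admissible_hasFinComponent_ofChar (μ := μ₁) Θ⁻¹
  have hσ : ∀ (w : Pl L) (c₀ : IrrClass (localPi L (IsCMField.complexConj L) 1 (Matrix.of fun i j : Fin 1 => if i.val + j.val + 1 = 1 then (1 : L) else 0) w)),
      c₀.IsConstituentOf (σ.comp (inclPlace (↥(maximalRealSubfield L)) L (IsCMField.complexConj L) 1 (Matrix.of fun i j : Fin 1 => if i.val + j.val + 1 = 1 then (1 : L) else 0) w)) ↔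
      c₀ = IrrClass.comap (localPiEquiv L (IsCMField.complexConj L) 1 (Matrix.of fun i j : Fin 1 => if i.val + j.val + 1 = 1 then (1 : L) else 0) w)
        (IrrClass.mk (SmoothIrrep.ofChar (θloc w) (hθo w))) := fun w c₀ =>
    ((F0P3FinPartConstituentTransfer.smoothConstituents_iff_of_hasFinComponent P hirr hadm hPσ w c₀).symm.trans (key w c₀)).trans
      (Iff.of_eq (congrArg (fun x => c₀ = x) (hcm w).symm))
  refine ⟨⟨P, W, _, _, σ, hirr, hadm.isSmooth, hadm, hPσ, hσ⟩, ⟨P, W, _, _, σ, rfl, hPσ, hirr, hadm.isSmooth, hadm, hσ⟩, ?_⟩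
  refine le_antisymm ?_ (DiscreteClass.one_le_mult_mk P)
  rw [DiscreteClass.mult_mk]
  exact (multiplicity_le_one_and_isOneDimensional_adelicGroupData_one L (Matrix.of fun i j : Fin 1 => if i.val + j.val + 1 = 1 then (1 : L) else 0) μ₁ P).1

/-- (R4′) **THE θ-BLOCK `θ hθ χv hχv` OF ★ `S10HDatum` FOR AN ARBITRARY AUTOMORPHIC CHARACTER `Θ`, given automorphic `μ₁`** (RULING J-θ: hypothesis-first over the abstract line):
`θ := (⟦ℂ_{θloc w}⟧)_w`, `χv := θloc v` pinned by EQUATIONS, `hθ` = occurrence, `hχv` = (R4-1′) at `w = v`. [cite: Rogawski1990, §13.8 p. 218 L9–10, p. 219 L1–2; §13.3 pp. 202–203] -/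
theorem thetaLine_of_char_of_measure (v : Pl L) [MeasurableSpace (H1Loc L v)] [BorelSpace (H1Loc L v)]
    (μ₁ : Measure (H1 L).automorphicQuotient) [(H1 L).IsAutomorphicMeasure μ₁]
    (ν₁v : Measure (H1Loc L v)) [ν₁v.IsMulLeftInvariant] [IsFiniteMeasureOnCompacts ν₁v]
    (Θ : (H1 L).AutomorphicCharacter) (θloc : ∀ w : Pl L, H1Loc L w →* ℂˣ)
    (hθo : ∀ w : Pl L, IsOpen ((((θloc w).ker : Subgroup (H1Loc L w))) : Set (H1Loc L w)))
    (hΘ : ∀ (w : Pl L) (u : localPi L (IsCMField.complexConj L) 1 (Matrix.of fun i j : Fin 1 => if i.val + j.val + 1 = 1 then (1 : L) else 0) w),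
      θloc w (localPiEquiv L (IsCMField.complexConj L) 1 (Matrix.of fun i j : Fin 1 => if i.val + j.val + 1 = 1 then (1 : L) else 0) w u) =
        Θ (inclPlaceAdelic (↥(maximalRealSubfield L)) L (IsCMField.complexConj L) 1 (Matrix.of fun i j : Fin 1 => if i.val + j.val + 1 = 1 then (1 : L) else 0) w u)) :
    ∃ (θ : ∀ w : Pl L, IrrClass (H1Loc L w)) (χv : H1Loc L v → ℂ),
      cmOccursInDiscreteSpectrum L 1 (Matrix.of fun i j : Fin 1 => if i.val + j.val + 1 = 1 then (1 : L) else 0) μ₁ θ ∧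
      (θ = fun w : Pl L => (IrrClass.mk (SmoothIrrep.ofChar (θloc w) (hθo w)) : IrrClass (H1Loc L w))) ∧
      (χv = fun z => ((θloc v z : ℂˣ) : ℂ)) ∧
      ∀ f₁ : H1Loc L v → ℂ, IsLocSmooth f₁ → (θ v).smoothTrace ν₁v f₁ = ∫ z, f₁ z * χv z ∂ν₁v :=
  ⟨_, _, (charLine_occurs_linked_multOne L μ₁ Θ θloc hθo hΘ).1, rfl, rfl, fun f₁ hf => smoothTrace_charClass_eq_integral L v (θloc v) (hθo v) ν₁v f₁ hf⟩

/-- (R4′, closed) **THE θ-BLOCK `μ₁ [hμ₁] θ hθ (ν₁v) χv hχv` FOR AN ARBITRARY AUTOMORPHIC CHARACTER `Θ`**, `μ₁` produced by ★ `exists_isAutomorphicMeasure_H1`.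
[cite: Rogawski1990, §13.8 p. 218 L9–10, p. 219 L1–2] [cite: Borel1963, Thm. 5.8] -/
theorem thetaLine_of_char (v : Pl L) [MeasurableSpace (H1Loc L v)] [BorelSpace (H1Loc L v)]
    (ν₁v : Measure (H1Loc L v)) [ν₁v.IsMulLeftInvariant] [IsFiniteMeasureOnCompacts ν₁v]
    (Θ : (H1 L).AutomorphicCharacter) (θloc : ∀ w : Pl L, H1Loc L w →* ℂˣ)
    (hθo : ∀ w : Pl L, IsOpen ((((θloc w).ker : Subgroup (H1Loc L w))) : Set (H1Loc L w)))
    (hΘ : ∀ (w : Pl L) (u : localPi L (IsCMField.complexConj L) 1 (Matrix.of fun i j : Fin 1 => if i.val + j.val + 1 = 1 then (1 : L) else 0) w),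
      θloc w (localPiEquiv L (IsCMField.complexConj L) 1 (Matrix.of fun i j : Fin 1 => if i.val + j.val + 1 = 1 then (1 : L) else 0) w u) =
        Θ (inclPlaceAdelic (↥(maximalRealSubfield L)) L (IsCMField.complexConj L) 1 (Matrix.of fun i j : Fin 1 => if i.val + j.val + 1 = 1 then (1 : L) else 0) w u)) :
    ∃ (μ₁ : Measure (H1 L).automorphicQuotient) (_ : (H1 L).IsAutomorphicMeasure μ₁) (θ : ∀ w : Pl L, IrrClass (H1Loc L w)) (χv : H1Loc L v → ℂ),
      cmOccursInDiscreteSpectrum L 1 (Matrix.of fun i j : Fin 1 => if i.val + j.val + 1 = 1 then (1 : L) else 0) μ₁ θ ∧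
      (θ = fun w : Pl L => (IrrClass.mk (SmoothIrrep.ofChar (θloc w) (hθo w)) : IrrClass (H1Loc L w))) ∧
      (χv = fun z => ((θloc v z : ℂˣ) : ℂ)) ∧
      ∀ f₁ : H1Loc L v → ℂ, IsLocSmooth f₁ → (θ v).smoothTrace ν₁v f₁ = ∫ z, f₁ z * χv z ∂ν₁v := by
  obtain ⟨μ₁, hμ₁⟩ := exists_isAutomorphicMeasure_H1 L
  haveI := hμ₁
  exact ⟨μ₁, hμ₁, thetaLine_of_char_of_measure L v μ₁ ν₁v Θ θloc hθo hΘ⟩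

/-- (R4′ + C-i) **THE θ-BLOCK AND ITS GLOBAL HALF TOGETHER, given `μ₁`**: `θ χv` (equations), `hθ`, `hχv`, and the discrete class `d₁ := mk (ofChar Θ⁻¹ μ₁)` of the line with
`hlink₁ : IsLinked … μ₁ d₁ θ` and `hd₁ : d₁.mult = 1` — the fields `θ hθ χv hχv d₁ hlink₁ hd₁` of ★ `S10HDatum` for the abstract line (the payer reads them by
`obtain ⟨θ, χv, d₁, hθ, rfl, rfl, hχv, hlink₁, hd₁, rfl⟩`). [cite: Rogawski1990, §13.8 p. 218 L9–10, p. 219 L1–2; §13.3 pp. 202–203; §11.1] [cite: Gelbart1975, Thm. 10.10] -/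
theorem thetaBlockC_of_char_of_measure (v : Pl L) [MeasurableSpace (H1Loc L v)] [BorelSpace (H1Loc L v)]
    (μ₁ : Measure (H1 L).automorphicQuotient) [(H1 L).IsAutomorphicMeasure μ₁]
    (ν₁v : Measure (H1Loc L v)) [ν₁v.IsMulLeftInvariant] [IsFiniteMeasureOnCompacts ν₁v]
    (Θ : (H1 L).AutomorphicCharacter) (θloc : ∀ w : Pl L, H1Loc L w →* ℂˣ)
    (hθo : ∀ w : Pl L, IsOpen ((((θloc w).ker : Subgroup (H1Loc L w))) : Set (H1Loc L w)))
    (hΘ : ∀ (w : Pl L) (u : localPi L (IsCMField.complexConj L) 1 (Matrix.of fun i j : Fin 1 => if i.val + j.val + 1 = 1 then (1 : L) else 0) w),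
      θloc w (localPiEquiv L (IsCMField.complexConj L) 1 (Matrix.of fun i j : Fin 1 => if i.val + j.val + 1 = 1 then (1 : L) else 0) w u) =
        Θ (inclPlaceAdelic (↥(maximalRealSubfield L)) L (IsCMField.complexConj L) 1 (Matrix.of fun i j : Fin 1 => if i.val + j.val + 1 = 1 then (1 : L) else 0) w u)) :
    ∃ (θ : ∀ w : Pl L, IrrClass (H1Loc L w)) (χv : H1Loc L v → ℂ) (d₁ : DiscreteClass (H1 L) μ₁),
      cmOccursInDiscreteSpectrum L 1 (Matrix.of fun i j : Fin 1 => if i.val + j.val + 1 = 1 then (1 : L) else 0) μ₁ θ ∧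
      (θ = fun w : Pl L => (IrrClass.mk (SmoothIrrep.ofChar (θloc w) (hθo w)) : IrrClass (H1Loc L w))) ∧
      (χv = fun z => ((θloc v z : ℂˣ) : ℂ)) ∧
      (∀ f₁ : H1Loc L v → ℂ, IsLocSmooth f₁ → (θ v).smoothTrace ν₁v f₁ = ∫ z, f₁ z * χv z ∂ν₁v) ∧
      IsLinked L 1 (Matrix.of fun i j : Fin 1 => if i.val + j.val + 1 = 1 then (1 : L) else 0) μ₁ d₁ θ ∧
      d₁.mult = 1 ∧
      d₁ = DiscreteClass.mk (DiscreteAutomorphicRep.ofChar Θ⁻¹ μ₁) := by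
  obtain ⟨hocc, hlink, hmult⟩ := charLine_occurs_linked_multOne L μ₁ Θ θloc hθo hΘ
  exact ⟨_, _, _, hocc, rfl, rfl, fun f₁ hf => smoothTrace_charClass_eq_integral L v (θloc v) (hθo v) ν₁v f₁ hf, hlink, hmult, rfl⟩

end Summit.HodgeConjecture.HodgeConjecture.R90.S10

end
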